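import Summits.HodgeConjecture.HodgeConjecture.Theses.FiniteTreeOfFlavours
import Literature.AlgebraicGeometry.HodgeTheory.IsoTransport
import Literature.AlgebraicGeometry.HodgeTheory.HypersurfaceLefschetz
import Literature.AlgebraicGeometry.Motives.CurveNet

/-!
# Birth skeleton (BC3) of the crux `MovableClassesAlgebraic` (stmt-HodgeConjecture-1493),
# route `FiniteTreeOfFlavours` — line `birth`: "explain the movable class at the generic fibre, then specialise"

The crux: for every smooth hypersurface `X ⊂ ℙⁿ⁺¹_ℂ` of degree `d` and every rational
`(k,k)`-class `c ∈ H²ᵏ(X(ℂ); ℂ)` that MOVES — `c = (e ≫ ι_t)^* Λ` for a rational `(k,k)`-class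
`Λ` on a smooth projective `(n+1)`-fold `𝒴` fibred by `π : 𝒴 ⟶ C` over a smooth projective
curve `C`, `e : X ≅ 𝒴_t` a fibre, only finitely many fibres `≅ X` — `c` is algebraic
(`c ∈ Nᵏ H²ᵏ(X(ℂ); ℂ) = algebraicClasses X k`). The route's own sentence for this crux is
"every positive-dimensional special subvariety of vector type is cycle-explained at its GENERIC
point (then SPECIALISE)" (route file, RANKED CRUXES (3)). The line types exactly that sentence on
the family `π` itself (no period-map vocabulary needed):

  * STUB 1 `stub_offMiddle` (known: Lefschetz's hyperplane theorem for hypersurfaces, Voisin II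
    Cor. 1.24–1.25; the tree's NAMED FACT `Voisin2003_smoothHypersurface_algebraicClasses_eq_top`,
    partially discharged in `HodgeTheory/HypersurfaceLefschetzUpper`) — off the middle degree,
    `2k ≠ n`, EVERY class of `H²ᵏ(X(ℂ); ℂ)` of a smooth hypersurface is algebraic (`ℂ · hᵏ`). So the
    crux lives in the middle degree `2k = n` (the route: "2k ≠ n gives only such classes").
  * STUB 2 `stub_genericFibres` (THE HEART; open — the crux moved to the generic point) — in the
    middle degree, for every moving datum `(𝒴, C, π, t, e, Λ)` of `X` as above, the restriction
    `Λ|_{𝒴_{t'}} = ι_{t'}^* Λ` is algebraic on the fibre `𝒴_{t'}` for all complex points `t'` OFF A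
    PROPER ZARISKI-CLOSED SUBSET `S ⊊ C` ("the movable class is cycle-explained at the general
    fibre of the family that moves it"). This is where the route's engines act: the image of `C` in
    `U_{n,d}/PGL` is a curve inside the Hodge locus of the flat transport of `c_prim`, i.e. inside a
    positive-dimensional special subvariety (finitely many maximal ones per `(n,d)` for `n ≥ 3`,
    `d ≥ 6`: Baldi–Klingler–Ullmo Thm. 2.6 / Cor. 2.7; defined over `ℚ̄`: Klingler–Otwinowska–Urbanik
    Cor. 1.13), whose generic point is to be explained by a relative cycle (small codimension:
    Otwinowska 2002; flag loci `{X ⊇ S}`: variational HC, Dan arXiv:1404.7519, Kloosterman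
    arXiv:2104.14845). Nothing is claimed at the special fibre `X = 𝒴_t` itself (`t ∈ S` allowed).
  * STUB 3 `stub_specialisation` (known in print: algebraicity of the fibre restrictions of a
    global class is a countable union of closed algebraic subsets of the base — relative Hilbert
    schemes have countably many proper components; Charles–Schnell Prop. 11.3.11, Voisin II §3.3.1
    and proof of Thm. 7.19, Voisin 2007 §0; the tree's NAMED FACT
    `charlesSchnell_algebraicityLocus_iUnion_closed` with the proof files `AlgebraicityLocus*`,
    `SupportedLocusClosed`, `AlgebraicClassesFibreRestriction`) — for ANY class `Λ ∈ H²ᵏ(𝒴(ℂ); ℂ)`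
    (no rationality, no Hodge type) on a smooth projective `(n+1)`-fold over a smooth projective
    curve: if `Λ|_{𝒴_{t'}}` is algebraic for all `t'` off a proper closed `S ⊊ C`, then `Λ|_{𝒴_t}` is
    algebraic at EVERY complex point `t` whose fibre is smooth projective of dimension `n` (over the
    smooth locus `U ∋ t` of `π` the algebraicity locus is `⋃_j W_j(ℂ)`, `W_j ⊆ U` closed; it contains
    the uncountable `(U ∖ S)(ℂ)`, so some `W_j = U ∋ t`).

  Composition (`MovableClassesAlgebraic_of`, kernel-checked, no `sorry`): if `2k ≠ n` STUB 1; else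
  STUB 2 gives `S`, STUB 3 gives `ι_t^* Λ ∈ Nᵏ H²ᵏ(𝒴_t(ℂ))` (the fibre `𝒴_t ≅ X` is smooth
  projective, `IsSmoothProjective.of_iso`), and `c = e^*(ι_t^* Λ)` is algebraic because algebraic
  classes transport along the isomorphism `e` (`mem_algebraicClasses_map_iff_of_iso`,
  `complexBetti.map_comp`).

## Contents

* `Stubs.stub_offMiddle`, `Stubs.stub_genericFibres`, `Stubs.stub_specialisation` — the three stub
  statements as named `Prop`s (so that the composition takes the stubs BY NAME, as the skeleton
  audit requires), with `Stubs.stub_…_iff : Stubs.stub_… ↔ <signature> := Iff.rfl`.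
* `stub_offMiddle`, `stub_genericFibres`, `stub_specialisation` — the three registered stubs, each
  `theorem stub_… : <signature verbatim> := by sorry` (`sorry` ONLY here).
* `MovableClassesAlgebraic_of : Stubs.stub_offMiddle → Stubs.stub_genericFibres →
  Stubs.stub_specialisation → MovableClassesAlgebraic` — STUB 1 → STUB 2 → STUB 3 → the crux BY NAME
  (`Summit.HodgeConjecture.HodgeConjecture.Theses.FiniteTreeOfFlavours.MovableClassesAlgebraic`),
  real proof; `MovableClassesAlgebraic_of_stubs` — the crux modulo exactly the three stubs.
* PROVED sanity: `stub_offMiddle_of_fact` — STUB 1 is the tree's named Lefschetz fact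
  (`Voisin2003_smoothHypersurface_algebraicClasses_eq_top.mem_algebraicClasses`), so it is exactly
  as hard as discharging that fact; `stub_specialisation_of_forall` — the degenerate instance
  `S = ∅` of STUB 3 is trivial (tightness: the content of STUB 3 is at the points of `S`);
  `movable_middle_of_generic_and_specialisation` — STUBS 2–3 alone give the middle-degree crux.
* BC5 special cases (PROVED): `stub_offMiddle_of_eq_zero_or_le` (STUB 1 for `k = 0` or `k ≥ n`,
  the degrees the tree owns), `stub_genericFibres_dim_zero` (the heart for `n = 0`, `S = ∅`).

Disproof used: none on file — `ledger crux ls stmt-HodgeConjecture-1493` showed no workfiles (no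
`Disproof.lean`, no `_false_without_` theorem, no landed Negative lemma) at registration
(2026-08-17); `ledger negatives --problem HodgeConjecture` has no statement about fibre restrictions
of classes on one-parameter families.
-/

noncomputable section

namespace Summit.HodgeConjecture.HodgeConjecture.Cruxes.MovableClassesAlgebraic.Birth

open CategoryTheory
open Literature.AlgebraicGeometry.Motives Literature.AlgebraicGeometry.HodgeTheory
open Summit.HodgeConjecture.HodgeConjecture.Theses.FiniteTreeOfFlavours (MovableClassesAlgebraic)

/-! ### The statements of the three stubs, by name

The composition below takes the stubs BY NAME (`Stubs.stub_…`: the declared stub statements of this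
Line — admissible skeleton hypotheses are recognised by the stub's name; the audit's stub attribute itself
is gate-reserved and is NOT applied here), as the skeleton audit requires; each
`theorem stub_… : <signature> := by sorry` further down inhabits the corresponding `def` (definitionally:
`Stubs.stub_…_iff` is `Iff.rfl`), and its signature is spelled out verbatim so that the registered stub
signature is the honest `Prop`, not an alias. -/

namespace Stubs

/-- Statement of STUB 1 (`stub_offMiddle`): off the middle degree every class of a smooth hypersurface
is algebraic. [cite: VoisinHodgeII2003, Cor. 1.24 and Cor. 1.25] -/
def stub_offMiddle : Prop :=
  ∀ ⦃n d : ℕ⦄ ⦃X : SchemeOver ℂ⦄, IsSmoothHypersurface n d X →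
    ∀ k : ℕ, 2 * k ≠ n → ∀ c : complexBetti X (2 * k), c ∈ algebraicClasses X k

/-- Statement of STUB 2 (`stub_genericFibres`, the heart): a movable middle-degree class is algebraic
on the fibres off a proper Zariski-closed subset of the base curve.
[cite: BaldiKlinglerUllmo2024, Thm. 2.6 and Cor. 2.7] -/
def stub_genericFibres : Prop :=
  ∀ ⦃n d : ℕ⦄ ⦃X : SchemeOver ℂ⦄, IsSmoothHypersurface n d X → ∀ k : ℕ, 2 * k = n →
    ∀ (𝒴 C : SchemeOver ℂ) (π : 𝒴 ⟶ C) (t : AlgPoints C ℂ) (_e : X ≅ fiberOver π t)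
      (Λ : complexBetti 𝒴 (2 * k)),
      IsSmoothProjective (n + 1) 𝒴 → IsSmoothProjective 1 C → IsRationalClass Λ →
      IsOfHodgeType (n + 1) 𝒴 (2 * k) k k Λ →
      Set.Finite {t' : AlgPoints C ℂ | Nonempty (fiberOver π t' ≅ X)} →
      ∃ S : Set C.left, IsClosed S ∧ S ≠ Set.univ ∧
        ∀ t' : AlgPoints C ℂ, t'.pt ∉ S →
          (complexBetti.map (fiberι π t') (2 * k)).hom Λ ∈ algebraicClasses (fiberOver π t') k

/-- Statement of STUB 3 (`stub_specialisation`): algebraicity of the fibre restrictions of a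
global class specialises from the fibres off a proper closed subset to every smooth fibre.
[cite: CharlesSchnell2014Notes, Prop. 11.3.11 (proof)] -/
def stub_specialisation : Prop :=
  ∀ ⦃n : ℕ⦄ ⦃𝒴 C : SchemeOver ℂ⦄ (π : 𝒴 ⟶ C),
    IsSmoothProjective (n + 1) 𝒴 → IsSmoothProjective 1 C →
    ∀ (k : ℕ) (Λ : complexBetti 𝒴 (2 * k)) (S : Set C.left), IsClosed S → S ≠ Set.univ →
      (∀ t' : AlgPoints C ℂ, t'.pt ∉ S →
        (complexBetti.map (fiberι π t') (2 * k)).hom Λ ∈ algebraicClasses (fiberOver π t') k) →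
      ∀ t : AlgPoints C ℂ, IsSmoothProjective n (fiberOver π t) →
        (complexBetti.map (fiberι π t) (2 * k)).hom Λ ∈ algebraicClasses (fiberOver π t) k

end Stubs

/-! ### The three registered stubs -/

/-- STUB 1 (known in print; L in the tree) — **off the middle degree every class of a smooth
hypersurface is algebraic.** For a smooth hypersurface `X ⊂ ℙⁿ⁺¹_ℂ` of dimension `n` (any degree
`d`) and every `k` with `2k ≠ n`, every class of `H²ᵏ(X(ℂ); ℂ)` lies in
`algebraicClasses X k = Nᵏ H²ᵏ(X(ℂ); ℂ)`: for `2k < n`, `H²ᵏ(X, ℤ) = ℤ · hᵏ` (Lefschetz's theorem on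
hyperplane sections via the Veronese embedding, Voisin II Thm. 1.23, Cor. 1.24); for
`n < 2k < 2n`, `H²ᵏ(X, ℤ) = ℤ · α` with `hᵏ = d · α ≠ 0` (Cor. 1.25, Poincaré duality); `k = 0`,
`k = n`, `k > n` are theorems of the tree (`algebraicClasses_zero`,
`mem_algebraicClasses_of_degree_top`, `algebraicClasses_eq_top_of_lt`). Equals the tree's named
fact `Voisin2003_smoothHypersurface_algebraicClasses_eq_top` in membership form
(`stub_offMiddle_of_fact` below). Why it might fail: it does not (theorem in print); in the tree the
range `0 < k < n` needs the Lefschetz hyperplane theorem with `ℂ`-coefficients for `V₊(F)`, in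
progress in `HodgeTheory/HypersurfaceLefschetzUpper`.
[cite: VoisinHodgeII2003, Thm. 1.23, Cor. 1.24 and Cor. 1.25 (§1.2.2)] -/
theorem stub_offMiddle :
    ∀ ⦃n d : ℕ⦄ ⦃X : SchemeOver ℂ⦄, IsSmoothHypersurface n d X →
      ∀ k : ℕ, 2 * k ≠ n → ∀ c : complexBetti X (2 * k), c ∈ algebraicClasses X k := by
  sorry

/-- STUB 2 (THE HEART; open — "cycle-explained at the generic point") — **a movable middle-degree
class is algebraic on the general fibre of the family that moves it.** For a smooth hypersurface
`X ⊂ ℙⁿ⁺¹_ℂ` of degree `d`, `2k = n`, a smooth projective `(n+1)`-fold `𝒴` with a morphism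
`π : 𝒴 ⟶ C` to a smooth projective curve, a complex point `t` with `e : X ≅ 𝒴_t`, only finitely
many fibres of `π` isomorphic to `X` (the family is not isotrivial: the moduli point moves), and a
RATIONAL class `Λ ∈ H²ᵏ(𝒴(ℂ); ℂ)` of Hodge type `(k,k)`: there is a proper Zariski-closed `S ⊊ C`
such that `Λ|_{𝒴_{t'}} := ι_{t'}^* Λ ∈ algebraicClasses (𝒴_{t'}) k` for every complex point `t'`
of `C` not over `S`. Implied by the Hodge conjecture (for `t'` in the smooth locus of `π` the fibre
is smooth projective, irreducible because `𝒴_t ≅ X` is, and `ι_{t'}^* Λ` is a rational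
`(k,k)`-class); conversely, with STUB 3 it gives the crux, and for `n ≥ 3` the general fibres are
again smooth hypersurfaces of degree `d` carrying the moved class, so this IS the crux at the
generic point of the special subvariety swept by `C` — where the route's engines apply: finiteness
of the maximal positive-dimensional special subvarieties of `U_{n,d}` for `n ≥ 3`, `d ≥ 6` and
their big monodromy (Baldi–Klingler–Ullmo Thm. 2.6, Cor. 2.7), `ℚ̄`-definability (KOU Cor. 1.13),
explanation of small-codimension components by linear subspaces (Otwinowska 2002) and of flag loci
`{X ⊇ S}` by the relative cycle `S` (variational HC: arXiv:1404.7519, arXiv:2104.14845),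
IVHS / Jacobian-ring rank conditions (Voisin II Ch. 5–6). Cases known outright: `n = 0` (`k = 0`),
`n = 2` (`k = 1`, Lefschetz `(1,1)` on the smooth fibres). Why it might fail: a positive-dimensional
component of the Hodge locus of `U_{n,d}` whose generic Hodge vector is explained by no relative
cycle is an HC-counterexample FAMILY (route kill criterion K1); below the first BKU layer the tree
of special subvarieties need not be finite (adjoint level of `G_Z` may drop to `≤ 2`).
[cite: BaldiKlinglerUllmo2024, Thm. 2.6 and Cor. 2.7] [cite: KlinglerOtwinowskaUrbanik2023, Cor. 1.13]
[cite: Otwinowska2002, Thm. 1] [cite: VoisinHodgeII2003, §5.3.3–§5.3.4 and §6.2] -/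
theorem stub_genericFibres :
    ∀ ⦃n d : ℕ⦄ ⦃X : SchemeOver ℂ⦄, IsSmoothHypersurface n d X → ∀ k : ℕ, 2 * k = n →
      ∀ (𝒴 C : SchemeOver ℂ) (π : 𝒴 ⟶ C) (t : AlgPoints C ℂ) (_e : X ≅ fiberOver π t)
        (Λ : complexBetti 𝒴 (2 * k)),
        IsSmoothProjective (n + 1) 𝒴 → IsSmoothProjective 1 C → IsRationalClass Λ →
        IsOfHodgeType (n + 1) 𝒴 (2 * k) k k Λ →
        Set.Finite {t' : AlgPoints C ℂ | Nonempty (fiberOver π t' ≅ X)} →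
        ∃ S : Set C.left, IsClosed S ∧ S ≠ Set.univ ∧
          ∀ t' : AlgPoints C ℂ, t'.pt ∉ S →
            (complexBetti.map (fiberι π t') (2 * k)).hom Λ ∈ algebraicClasses (fiberOver π t') k := by
  sorry

/-- STUB 3 (known in print; L–XL in the tree) — **algebraicity of the fibre restrictions of a
global class specialises from the general fibre to every smooth fibre.** For a smooth projective
`(n+1)`-fold `𝒴`, a smooth projective curve `C`, a morphism `π : 𝒴 ⟶ C`, ANY class
`Λ ∈ H²ᵏ(𝒴(ℂ); ℂ)` and a proper Zariski-closed `S ⊊ C`: if `ι_{t'}^* Λ` is algebraic on `𝒴_{t'}`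
for every complex `t'` not over `S`, then `ι_t^* Λ` is algebraic on `𝒴_t` for EVERY complex point
`t` whose fibre `𝒴_t` is smooth projective of dimension `n` (in particular at the finitely many
points of `S` with good fibre). Printed mechanism: over the smooth locus `U ∋ t` of `π` (open; `π`
is flat near the smooth fibre `𝒴_t`, and all smooth fibres are irreducible since `𝒴_t` is) the set
`{t'' ∈ U(ℂ) | ι_{t''}^* Λ algebraic}` is `⋃_j W_j(ℂ)` for countably many Zariski-closed `W_j ⊆ U`
(relative Hilbert schemes of `𝒴_U/U` are proper with countably many components; cycle classes of
flat families and `ι^* Λ` are flat sections of `R²ᵏ π_* ℂ`; Charles–Schnell, proof of Prop. 11.3.11;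
Voisin II §3.3.1 and proof of Thm. 7.19; the tree's named fact
`charlesSchnell_algebraicityLocus_iUnion_closed`), it contains the uncountable `(U ∖ S)(ℂ)`, so some
`W_j` is infinite, hence `W_j = U ∋ t` (`U` an irreducible curve). Equivalently: limits of
supported classes along the curve (Fulton §10.1, §20.3; the tree's
`AlgebraicityLocusCurves.mem_algebraicClasses_of_curve`, `SupportedLocusClosed`). No rationality
of `Λ` is needed. Why it might fail: it does not in print; in the tree the countability /
relative-Hilbert-scheme input (or the spreading of pointwise supports into a closed family of
supports over a multisection, cf. `spread_supports_over_projectiveLine`) is not yet proved, and the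
restriction of `π` to its smooth locus must be packaged as an `IsSmoothProjectiveFamily`.
[cite: CharlesSchnell2014Notes, Prop. 11.3.11 (proof)]
[cite: VoisinHodgeII2003, §3.3.1 and §7.3.2, proof of Thm. 7.19]
[cite: Voisin2007HodgeLoci, §0 (Introduction), first paragraph] [cite: Fulton1998, §10.1 and §20.3] -/
theorem stub_specialisation :
    ∀ ⦃n : ℕ⦄ ⦃𝒴 C : SchemeOver ℂ⦄ (π : 𝒴 ⟶ C),
      IsSmoothProjective (n + 1) 𝒴 → IsSmoothProjective 1 C →
      ∀ (k : ℕ) (Λ : complexBetti 𝒴 (2 * k)) (S : Set C.left), IsClosed S → S ≠ Set.univ →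
        (∀ t' : AlgPoints C ℂ, t'.pt ∉ S →
          (complexBetti.map (fiberι π t') (2 * k)).hom Λ ∈ algebraicClasses (fiberOver π t') k) →
        ∀ t : AlgPoints C ℂ, IsSmoothProjective n (fiberOver π t) →
          (complexBetti.map (fiberι π t) (2 * k)).hom Λ ∈ algebraicClasses (fiberOver π t) k := by
  sorry

/-! ### The composition: stub₁ → stub₂ → stub₃ → the crux, by name -/

/-- **THE LINE'S COMPOSITION** (kernel-checked, no `sorry`). Off the middle degree STUB 1. In the
middle degree: the moving datum `(𝒴, C, π, t, e, Λ)` of `c` is fed to STUB 2, which makes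
`ι_{t'}^* Λ` algebraic off a proper closed `S ⊊ C`; STUB 3 specialises this to the fibre
`𝒴_t ≅ X`, smooth projective of dimension `n` (`IsSmoothProjective.of_iso`); and
`c = (e ≫ ι_t)^* Λ = e^*(ι_t^* Λ)` (`complexBetti.map_comp`) is algebraic on `X` because algebraic
classes transport along the isomorphism `e` (`mem_algebraicClasses_map_iff_of_iso`). [folklore] -/
theorem MovableClassesAlgebraic_of (h₁ : Stubs.stub_offMiddle) (h₂ : Stubs.stub_genericFibres)
    (h₃ : Stubs.stub_specialisation) : MovableClassesAlgebraic := by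
  intro n d X hX k c hc hkk hmov
  by_cases hk : 2 * k = n
  · obtain ⟨𝒴, C, π, t, e, Λ, h𝒴, hC, hΛ, hΛkk, hres, hfin⟩ := hmov
    obtain ⟨S, hS, hSne, hgen⟩ := h₂ hX k hk 𝒴 C π t e Λ h𝒴 hC hΛ hΛkk hfin
    have ht : (complexBetti.map (fiberι π t) (2 * k)).hom Λ ∈ algebraicClasses (fiberOver π t) k :=
      h₃ π h𝒴 hC k Λ S hS hSne hgen t (hX.1.of_iso e)
    rw [← hres, complexBetti.map_comp, ModuleCat.hom_comp, LinearMap.comp_apply]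
    exact (mem_algebraicClasses_map_iff_of_iso e).2 ht
  · exact h₁ hX k hk c

/-- **The crux, closed modulo exactly the three registered stubs.** -/
theorem MovableClassesAlgebraic_of_stubs : MovableClassesAlgebraic :=
  MovableClassesAlgebraic_of stub_offMiddle stub_genericFibres stub_specialisation

/-- The by-name statement of STUB 1 is, definitionally, the registered signature. [folklore] -/
theorem Stubs.stub_offMiddle_iff : Stubs.stub_offMiddle ↔
    ∀ ⦃n d : ℕ⦄ ⦃X : SchemeOver ℂ⦄, IsSmoothHypersurface n d X →
      ∀ k : ℕ, 2 * k ≠ n → ∀ c : complexBetti X (2 * k), c ∈ algebraicClasses X k :=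
  Iff.rfl

/-- The by-name statement of STUB 2 is, definitionally, the registered signature. [folklore] -/
theorem Stubs.stub_genericFibres_iff : Stubs.stub_genericFibres ↔
    ∀ ⦃n d : ℕ⦄ ⦃X : SchemeOver ℂ⦄, IsSmoothHypersurface n d X → ∀ k : ℕ, 2 * k = n →
      ∀ (𝒴 C : SchemeOver ℂ) (π : 𝒴 ⟶ C) (t : AlgPoints C ℂ) (_e : X ≅ fiberOver π t)
        (Λ : complexBetti 𝒴 (2 * k)),
        IsSmoothProjective (n + 1) 𝒴 → IsSmoothProjective 1 C → IsRationalClass Λ →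
        IsOfHodgeType (n + 1) 𝒴 (2 * k) k k Λ →
        Set.Finite {t' : AlgPoints C ℂ | Nonempty (fiberOver π t' ≅ X)} →
        ∃ S : Set C.left, IsClosed S ∧ S ≠ Set.univ ∧
          ∀ t' : AlgPoints C ℂ, t'.pt ∉ S →
            (complexBetti.map (fiberι π t') (2 * k)).hom Λ ∈ algebraicClasses (fiberOver π t') k :=
  Iff.rfl

/-- The by-name statement of STUB 3 is, definitionally, the registered signature. [folklore] -/
theorem Stubs.stub_specialisation_iff : Stubs.stub_specialisation ↔
    ∀ ⦃n : ℕ⦄ ⦃𝒴 C : SchemeOver ℂ⦄ (π : 𝒴 ⟶ C),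
      IsSmoothProjective (n + 1) 𝒴 → IsSmoothProjective 1 C →
      ∀ (k : ℕ) (Λ : complexBetti 𝒴 (2 * k)) (S : Set C.left), IsClosed S → S ≠ Set.univ →
        (∀ t' : AlgPoints C ℂ, t'.pt ∉ S →
          (complexBetti.map (fiberι π t') (2 * k)).hom Λ ∈ algebraicClasses (fiberOver π t') k) →
        ∀ t : AlgPoints C ℂ, IsSmoothProjective n (fiberOver π t) →
          (complexBetti.map (fiberι π t) (2 * k)).hom Λ ∈ algebraicClasses (fiberOver π t) k :=
  Iff.rfl

/-! ### Proved sanity (no `sorry`): what each stub is worth -/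

/-- **STUB 1 is the tree's named Lefschetz fact** (membership form, all `k` with `2k ≠ n`): granted
`Voisin2003_smoothHypersurface_algebraicClasses_eq_top`, STUB 1 holds — so STUB 1 is exactly the
discharge of that fact, neither more nor less. [cite: VoisinHodgeII2003, Cor. 1.24 and Cor. 1.25] -/
theorem stub_offMiddle_of_fact (h : Voisin2003_smoothHypersurface_algebraicClasses_eq_top) :
    Stubs.stub_offMiddle :=
  fun _ _ _ hX _ hk c ↦ h.mem_algebraicClasses hX hk c

/-- **Tightness of STUB 3**: its degenerate instance `S = ∅` (every fibre already explained) is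
trivial — the content of STUB 3 is precisely at the finitely many points of `S`, i.e. it is a
genuine SPECIALISATION statement and not a reformulation of its hypothesis. [folklore] -/
theorem stub_specialisation_of_forall {𝒴 C : SchemeOver ℂ} (π : 𝒴 ⟶ C) (k : ℕ)
    (Λ : complexBetti 𝒴 (2 * k))
    (h : ∀ t' : AlgPoints C ℂ, t'.pt ∉ (∅ : Set C.left) →
      (complexBetti.map (fiberι π t') (2 * k)).hom Λ ∈ algebraicClasses (fiberOver π t') k)
    (t : AlgPoints C ℂ) :
    (complexBetti.map (fiberι π t) (2 * k)).hom Λ ∈ algebraicClasses (fiberOver π t) k :=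
  h t (Set.notMem_empty _)

/-- **STUBS 2–3 alone give the middle-degree crux** (the case split of the composition made
explicit: STUB 1 is used only off the middle degree, STUBS 2–3 only in it — all three are
load-bearing and none is idle). [folklore] -/
theorem movable_middle_of_generic_and_specialisation
    (h₂ : Stubs.stub_genericFibres) (h₃ : Stubs.stub_specialisation)
    ⦃n d : ℕ⦄ ⦃X : SchemeOver ℂ⦄ (hX : IsSmoothHypersurface n d X) (k : ℕ) (hk : 2 * k = n)
    (c : complexBetti X (2 * k))
    (hmov : ∃ (𝒴 C : SchemeOver ℂ) (π : 𝒴 ⟶ C) (t : AlgPoints C ℂ) (e : X ≅ fiberOver π t)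
      (Λ : complexBetti 𝒴 (2 * k)),
      IsSmoothProjective (n + 1) 𝒴 ∧ IsSmoothProjective 1 C ∧ IsRationalClass Λ ∧
        IsOfHodgeType (n + 1) 𝒴 (2 * k) k k Λ ∧
        (complexBetti.map (e.hom ≫ fiberι π t) (2 * k)).hom Λ = c ∧
        Set.Finite {t' : AlgPoints C ℂ | Nonempty (fiberOver π t' ≅ X)}) :
    c ∈ algebraicClasses X k := by
  obtain ⟨𝒴, C, π, t, e, Λ, h𝒴, hC, hΛ, hΛkk, hres, hfin⟩ := hmov
  obtain ⟨S, hS, hSne, hgen⟩ := h₂ hX k hk 𝒴 C π t e Λ h𝒴 hC hΛ hΛkk hfin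
  have ht : (complexBetti.map (fiberι π t) (2 * k)).hom Λ ∈ algebraicClasses (fiberOver π t) k :=
    h₃ π h𝒴 hC k Λ S hS hSne hgen t (hX.1.of_iso e)
  rw [← hres, complexBetti.map_comp, ModuleCat.hom_comp, LinearMap.comp_apply]
  exact (mem_algebraicClasses_map_iff_of_iso e).2 ht

/-! ### BC5 special cases (no `sorry`): the stubs are inhabited in kind -/

/-- **STUB 1 in the degrees the tree already owns** (`k = 0` or `k ≥ n`): there
`algebraicClasses X k = ⊤` unconditionally (`algebraicClasses_eq_top_of_eq_zero_or_le`: `N⁰ = H⁰`,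
top degree spanned by the class of a point, `H²ᵏ = 0` above the dimension); the open range of
STUB 1 is exactly `0 < k < n`, `2k ≠ n` — the named Lefschetz fact. [cite: VoisinHodgeI2002, §11.1.2 and §11.3] -/
theorem stub_offMiddle_of_eq_zero_or_le ⦃n d : ℕ⦄ ⦃X : SchemeOver ℂ⦄ (hX : IsSmoothHypersurface n d X)
    (k : ℕ) (hk : k = 0 ∨ n ≤ k) (c : complexBetti X (2 * k)) : c ∈ algebraicClasses X k := by
  rw [algebraicClasses_eq_top_of_eq_zero_or_le hX.1 hk]
  exact Submodule.mem_top

/-- **The heart in dimension `n = 0`** (so `k = 0`; `X` a point `V₊(ℓ) ⊂ ℙ¹`, `𝒴` a curve over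
`C`): PROVED — `S = ∅` works since `algebraicClasses _ 0 = ⊤` on every fibre and `C`, a smooth
projective curve, is irreducible hence non-empty (so `∅ ≠ C`). Shows the binders of STUB 2 compute
on the tree's carriers; the first open case is `n = 2k ≥ 4` (for `n = 2` it is Lefschetz `(1,1)` on
the smooth fibres). [folklore] -/
theorem stub_genericFibres_dim_zero :
    ∀ ⦃d : ℕ⦄ ⦃X : SchemeOver ℂ⦄, IsSmoothHypersurface 0 d X → ∀ k : ℕ, 2 * k = 0 →
      ∀ (𝒴 C : SchemeOver ℂ) (π : 𝒴 ⟶ C) (t : AlgPoints C ℂ) (_e : X ≅ fiberOver π t)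
        (Λ : complexBetti 𝒴 (2 * k)),
        IsSmoothProjective (0 + 1) 𝒴 → IsSmoothProjective 1 C → IsRationalClass Λ →
        IsOfHodgeType (0 + 1) 𝒴 (2 * k) k k Λ →
        Set.Finite {t' : AlgPoints C ℂ | Nonempty (fiberOver π t' ≅ X)} →
        ∃ S : Set C.left, IsClosed S ∧ S ≠ Set.univ ∧
          ∀ t' : AlgPoints C ℂ, t'.pt ∉ S →
            (complexBetti.map (fiberι π t') (2 * k)).hom Λ ∈ algebraicClasses (fiberOver π t') k := by
  intro d X _ k hk 𝒴 C π t _ Λ _ hC _ _ _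
  obtain rfl : k = 0 := by omega
  haveI := hC.geometricallyIrreducible
  haveI : IrreducibleSpace C.left :=
    AlgebraicGeometry.GeometricallyIrreducible.irreducibleSpace_of_subsingleton C.hom
  refine ⟨∅, isClosed_empty, ?_, fun t' _ ↦ ?_⟩
  · intro h
    obtain ⟨x⟩ := (inferInstance : Nonempty C.left)
    have hx : x ∈ (∅ : Set C.left) := h ▸ Set.mem_univ x
    exact hx
  · rw [algebraicClasses_zero]
    exact Submodule.mem_top

end Summit.HodgeConjecture.HodgeConjecture.Cruxes.MovableClassesAlgebraic.Birth

end
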